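import Literature.NumberTheory.Automorphic.AdelicPiSchwartzBruhatFourier
import Literature.NumberTheory.Automorphic.GLnAdelicStructureProofs
import HarnessLib

/-!
# Indicators of compact open cosets are Schwartz–Bruhat; the thin-coset test functions `Φ_∞ ⊗ 𝟙_{x₀ + 𝔫𝒪̂^ι}`

Topic `NumberTheory/Automorphic`; namespace `Literature.NumberTheory.Automorphic`. Kernel glue
(theorems + two abbreviating definitions, every declaration proved, no named fact) for the
finite-adelic half of the theta test functions used in non-vanishing arguments for theta lifts
("take `φ_f` the characteristic function of a small coset `x₀ + N L̂`", Weil (1964) n° 19–20 standard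
functions; Gelbart (1976), §2; Kudla (1994) "splitting", §3 test vectors):

* §1 (any topological space `X`): `indicator_const_mem_schwartzBruhat` — the indicator of a compact
  open-closed set (times a constant) is Schwartz–Bruhat (`SchwartzBruhat` of `TateLocalFactors`:
  locally constant + compact support); `comp_homeomorph_mem_schwartzBruhat` — transport along a
  homeomorphism.
* §2 (a topological additive group `A`): `indicator_vadd_addSubgroup_mem_schwartzBruhat` — for a
  compact open subgroup `H ≤ A` and `x₀ : A`, `𝟙_{x₀ + H} ∈ 𝒮(A)`; translation stability
  `comp_add_left_mem_schwartzBruhat`, `comp_sub_right_mem_schwartzBruhat`; the value formula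
  `indicator_vadd_addSubgroup_apply` (`_of_mem` / `_of_not_mem`).
* §3 (`(𝔸_K^∞)^ι`): `isCompact_piLevelIdeal` — the level box `(𝔫𝒪̂_K)^ι` (`piLevelIdeal`) is
  compact (closed in the compact box `𝒪̂^ι`); **`indicator_thinCoset_mem_schwartzBruhat`** —
  `𝟙_{x₀ + (𝔫𝒪̂_K)^ι} ∈ 𝒮((𝔸_K^∞)^ι)`; and the pure tensor
  **`thinCosetTestFun K ι Φ_∞ x₀ 𝔫 := Φ_∞ ⊗ 𝟙_{x₀ + (𝔫𝒪̂_K)^ι} ∈ piSchwartzBruhat K ι`**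
  (`thinCosetTestFun_mem_piSchwartzBruhat`), with its evaluation `thinCosetTestFun_apply`
  (`_of_mem` / `_of_not_mem`) and `thinCoset_mono`.

Folklore (Weil (1964) n° 19; Tate (1967), §3.2; Bump (1997), §3.1).
-/

noncomputable section

open Set NumberField NumberField.InfinitePlace NumberField.mixedEmbedding IsDedekindDomain
open scoped Pointwise SchwartzMap

namespace Literature.NumberTheory.Automorphic

/-! ## 1. Indicators of compact clopen sets; transport along homeomorphisms -/

section General

variable {X Y : Type*} [TopologicalSpace X] [TopologicalSpace Y]

/-- The indicator of an open, closed and compact set (with a constant value) is a Schwartz–Bruhat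
function: locally constant (the set and its complement are open) and compactly supported.
[folklore] -/
theorem indicator_const_mem_schwartzBruhat {U : Set X} (hUo : IsOpen U) (hUcl : IsClosed U)
    (hUc : IsCompact U) (c : ℂ) : U.indicator (fun _ => c) ∈ SchwartzBruhat X := by
  refine ⟨(IsLocallyConstant.iff_exists_open _).2 fun x => ?_,
    HasCompactSupport.intro' hUc hUcl fun x hx => Set.indicator_of_notMem hx _⟩
  by_cases hx : x ∈ U
  · exact ⟨U, hUo, hx, fun y hy => by rw [Set.indicator_of_mem hy, Set.indicator_of_mem hx]⟩
  · exact ⟨Uᶜ, hUcl.isOpen_compl, hx, fun y hy => by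
      rw [Set.indicator_of_notMem (Set.notMem_of_mem_compl hy), Set.indicator_of_notMem hx]⟩

/-- Schwartz–Bruhat functions transport along homeomorphisms: `f ∈ 𝒮(Y) ⇒ f ∘ e ∈ 𝒮(X)`.
[folklore] -/
theorem comp_homeomorph_mem_schwartzBruhat (e : X ≃ₜ Y) {f : Y → ℂ} (hf : f ∈ SchwartzBruhat Y) :
    f ∘ e ∈ SchwartzBruhat X :=
  ⟨hf.1.comp_continuous e.continuous, hf.2.comp_homeomorph e⟩

end General

/-! ## 2. Cosets of compact open subgroups of a topological additive group -/

section AddGroup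

variable {A : Type*} [AddGroup A] [TopologicalSpace A] [IsTopologicalAddGroup A]

/-- Left translates of Schwartz–Bruhat functions are Schwartz–Bruhat: `x ↦ f (a + x)`. [folklore] -/
theorem comp_add_left_mem_schwartzBruhat {f : A → ℂ} (hf : f ∈ SchwartzBruhat A) (a : A) :
    (fun x => f (a + x)) ∈ SchwartzBruhat A :=
  comp_homeomorph_mem_schwartzBruhat (Homeomorph.addLeft a) hf

/-- Right translates of Schwartz–Bruhat functions are Schwartz–Bruhat: `x ↦ f (x - a)`. [folklore] -/
theorem comp_sub_right_mem_schwartzBruhat {f : A → ℂ} (hf : f ∈ SchwartzBruhat A) (a : A) :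
    (fun x => f (x - a)) ∈ SchwartzBruhat A :=
  comp_homeomorph_mem_schwartzBruhat (Homeomorph.subRight a) hf

/-- A coset `x₀ + H` of a compact open subgroup is open, closed and compact. [folklore] -/
theorem isOpen_isClosed_isCompact_vadd_addSubgroup (H : AddSubgroup A) (hHo : IsOpen (H : Set A))
    (hHc : IsCompact (H : Set A)) (x₀ : A) :
    IsOpen (x₀ +ᵥ (H : Set A)) ∧ IsClosed (x₀ +ᵥ (H : Set A)) ∧ IsCompact (x₀ +ᵥ (H : Set A)) := by
  refine ⟨?_, ?_, ?_⟩
  · rw [← Set.image_vadd]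
    exact (Homeomorph.addLeft x₀).isOpenMap _ hHo
  · rw [← Set.image_vadd]
    exact (Homeomorph.addLeft x₀).isClosedMap _ (H.isClosed_of_isOpen hHo)
  · simpa only [Set.image_vadd] using hHc.image (continuous_const_vadd x₀)

/-- **The indicator of a coset of a compact open subgroup is Schwartz–Bruhat**:
`c • 𝟙_{x₀ + H} ∈ 𝒮(A)`. [folklore] -/
theorem indicator_vadd_addSubgroup_mem_schwartzBruhat (H : AddSubgroup A) (hHo : IsOpen (H : Set A))
    (hHc : IsCompact (H : Set A)) (x₀ : A) (c : ℂ) :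
    (x₀ +ᵥ (H : Set A)).indicator (fun _ => c) ∈ SchwartzBruhat A := by
  obtain ⟨ho, hcl, hc⟩ := isOpen_isClosed_isCompact_vadd_addSubgroup H hHo hHc x₀
  exact indicator_const_mem_schwartzBruhat ho hcl hc c

omit [TopologicalSpace A] [IsTopologicalAddGroup A] in
/-- Value of the coset indicator ON the coset: `𝟙_{x₀ + H}(x) = c` if `-x₀ + x ∈ H`. [folklore] -/
theorem indicator_vadd_addSubgroup_of_mem (H : AddSubgroup A) (x₀ : A) (c : ℂ) {x : A}
    (hx : -x₀ + x ∈ H) : (x₀ +ᵥ (H : Set A)).indicator (fun _ => c) x = c :=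
  Set.indicator_of_mem (Set.mem_vadd_set_iff_neg_vadd_mem.2 hx) _

omit [TopologicalSpace A] [IsTopologicalAddGroup A] in
/-- Value of the coset indicator OFF the coset: `𝟙_{x₀ + H}(x) = 0` if `-x₀ + x ∉ H`. [folklore] -/
theorem indicator_vadd_addSubgroup_of_not_mem (H : AddSubgroup A) (x₀ : A) (c : ℂ) {x : A}
    (hx : -x₀ + x ∉ H) : (x₀ +ᵥ (H : Set A)).indicator (fun _ => c) x = 0 :=
  Set.indicator_of_notMem (fun h => hx (Set.mem_vadd_set_iff_neg_vadd_mem.1 h)) _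

omit [TopologicalSpace A] [IsTopologicalAddGroup A] in
/-- Value of the coset indicator: `𝟙_{x₀ + H}(x) = c` if `-x₀ + x ∈ H`, else `0`. [folklore] -/
theorem indicator_vadd_addSubgroup_apply (H : AddSubgroup A) (x₀ : A) (c : ℂ) (x : A)
    [Decidable (-x₀ + x ∈ H)] :
    (x₀ +ᵥ (H : Set A)).indicator (fun _ => c) x = if -x₀ + x ∈ H then c else 0 := by
  split_ifs with hx
  · exact indicator_vadd_addSubgroup_of_mem H x₀ c hx
  · exact indicator_vadd_addSubgroup_of_not_mem H x₀ c hx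

end AddGroup

/-! ## 3. Thin cosets `x₀ + (𝔫𝒪̂_K)^ι` in `(𝔸_K^∞)^ι` and the test functions `Φ_∞ ⊗ 𝟙_{x₀ + (𝔫𝒪̂_K)^ι}` -/

section FiniteAdele

open scoped Classical

variable (K : Type) [Field K] [NumberField K] (ι : Type) [Fintype ι]

omit [Fintype ι] in
/-- The level box `(𝔫𝒪̂_K)^ι ⊆ (𝔸_K^∞)^ι` lies in the integral box `𝒪̂^ι`. [folklore] -/
theorem piLevelIdeal_subset_pi_integralFiniteAdeles (𝔫 : Ideal (𝓞 K)) :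
    (piLevelIdeal K ι 𝔫 : Set (ι → FiniteAdeleRing (𝓞 K) K)) ⊆
      Set.pi Set.univ fun _ => (integralFiniteAdeles K : Set (FiniteAdeleRing (𝓞 K) K)) :=
  fun _ hl i _ => mem_integralFiniteAdeles_of_mem_levelIdeal ((mem_piLevelIdeal_iff K).1 hl i)

/-- **The level box `(𝔫𝒪̂_K)^ι` is compact**: an open (hence closed) subgroup inside the compact box
`𝒪̂^ι`. [folklore] -/
theorem isCompact_piLevelIdeal (𝔫 : Ideal (𝓞 K)) :
    IsCompact (piLevelIdeal K ι 𝔫 : Set (ι → FiniteAdeleRing (𝓞 K) K)) :=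
  (isCompact_univ_pi fun _ => isCompact_integralFiniteAdeles K).of_isClosed_subset
    ((piLevelIdeal K ι 𝔫).isClosed_of_isOpen (isOpen_piLevelIdeal K 𝔫))
    (piLevelIdeal_subset_pi_integralFiniteAdeles K ι 𝔫)

/-- **The indicator of a thin coset `x₀ + (𝔫𝒪̂_K)^ι` is a Schwartz–Bruhat function on `(𝔸_K^∞)^ι`.**
[folklore] -/
theorem indicator_thinCoset_mem_schwartzBruhat (x₀ : ι → FiniteAdeleRing (𝓞 K) K) (𝔫 : Ideal (𝓞 K))
    (c : ℂ) :
    (x₀ +ᵥ (piLevelIdeal K ι 𝔫 : Set (ι → FiniteAdeleRing (𝓞 K) K))).indicator (fun _ => c) ∈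
      SchwartzBruhat (ι → FiniteAdeleRing (𝓞 K) K) :=
  indicator_vadd_addSubgroup_mem_schwartzBruhat _ (isOpen_piLevelIdeal K 𝔫)
    (isCompact_piLevelIdeal K ι 𝔫) x₀ c

/-- **The thin-coset test function `Φ_∞ ⊗ 𝟙_{x₀ + (𝔫𝒪̂_K)^ι}` on `𝔸_K^ι`**: archimedean factor a
Schwartz function `Φ_∞` on `(K ⊗ ℝ)^ι` (read through `piArch`), finite factor the indicator of the
thin coset (read through `piFinite`). [folklore] -/
def thinCosetTestFun (Φinf : 𝓢((ι → mixedSpace K), ℂ))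
    (x₀ : ι → FiniteAdeleRing (𝓞 K) K) (𝔫 : Ideal (𝓞 K)) : (ι → AdeleRing (𝓞 K) K) → ℂ :=
  fun v => Φinf (piArch K ι v) *
    (x₀ +ᵥ (piLevelIdeal K ι 𝔫 : Set (ι → FiniteAdeleRing (𝓞 K) K))).indicator (fun _ => (1 : ℂ))
      (piFinite K ι v)

variable {K ι}

/-- Evaluation of the thin-coset test function ON the coset: `Φ_∞(v_∞)` if `-x₀ + v_f ∈ (𝔫𝒪̂_K)^ι`.
[folklore] -/
theorem thinCosetTestFun_of_mem (Φinf : 𝓢((ι → mixedSpace K), ℂ))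
    (x₀ : ι → FiniteAdeleRing (𝓞 K) K) (𝔫 : Ideal (𝓞 K)) {v : ι → AdeleRing (𝓞 K) K}
    (hv : -x₀ + piFinite K ι v ∈ piLevelIdeal K ι 𝔫) :
    thinCosetTestFun K ι Φinf x₀ 𝔫 v = Φinf (piArch K ι v) := by
  rw [thinCosetTestFun, indicator_vadd_addSubgroup_of_mem _ x₀ 1 hv, mul_one]

/-- Evaluation of the thin-coset test function OFF the coset: `0` if `-x₀ + v_f ∉ (𝔫𝒪̂_K)^ι`.
[folklore] -/
theorem thinCosetTestFun_of_not_mem (Φinf : 𝓢((ι → mixedSpace K), ℂ))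
    (x₀ : ι → FiniteAdeleRing (𝓞 K) K) (𝔫 : Ideal (𝓞 K)) {v : ι → AdeleRing (𝓞 K) K}
    (hv : -x₀ + piFinite K ι v ∉ piLevelIdeal K ι 𝔫) :
    thinCosetTestFun K ι Φinf x₀ 𝔫 v = 0 := by
  rw [thinCosetTestFun, indicator_vadd_addSubgroup_of_not_mem _ x₀ 1 hv, mul_zero]

/-- Evaluation of the thin-coset test function: `Φ_∞(v_∞)` if `-x₀ + v_f ∈ (𝔫𝒪̂_K)^ι`, else `0`.
[folklore] -/
theorem thinCosetTestFun_apply (Φinf : 𝓢((ι → mixedSpace K), ℂ))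
    (x₀ : ι → FiniteAdeleRing (𝓞 K) K) (𝔫 : Ideal (𝓞 K)) (v : ι → AdeleRing (𝓞 K) K)
    [Decidable (-x₀ + piFinite K ι v ∈ piLevelIdeal K ι 𝔫)] :
    thinCosetTestFun K ι Φinf x₀ 𝔫 v =
      if -x₀ + piFinite K ι v ∈ piLevelIdeal K ι 𝔫 then Φinf (piArch K ι v) else 0 := by
  split_ifs with hv
  · exact thinCosetTestFun_of_mem Φinf x₀ 𝔫 hv
  · exact thinCosetTestFun_of_not_mem Φinf x₀ 𝔫 hv

/-- **The thin-coset test function is a (factorizable) Schwartz–Bruhat function on `𝔸_K^ι`.**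
[folklore] -/
theorem isFactorizablePiSchwartzBruhat_thinCosetTestFun
    (Φinf : 𝓢((ι → mixedSpace K), ℂ))
    (x₀ : ι → FiniteAdeleRing (𝓞 K) K) (𝔫 : Ideal (𝓞 K)) :
    IsFactorizablePiSchwartzBruhat K ι (thinCosetTestFun K ι Φinf x₀ 𝔫) :=
  ⟨Φinf, _, indicator_thinCoset_mem_schwartzBruhat K ι x₀ 𝔫 1, rfl⟩

/-- The thin-coset test function lies in `piSchwartzBruhat K ι = 𝒮(𝔸_K^ι)`. [folklore] -/
theorem thinCosetTestFun_mem_piSchwartzBruhat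
    (Φinf : 𝓢((ι → mixedSpace K), ℂ))
    (x₀ : ι → FiniteAdeleRing (𝓞 K) K) (𝔫 : Ideal (𝓞 K)) :
    thinCosetTestFun K ι Φinf x₀ 𝔫 ∈ piSchwartzBruhat K ι :=
  mem_piSchwartzBruhat (isFactorizablePiSchwartzBruhat_thinCosetTestFun Φinf x₀ 𝔫)

omit [Fintype ι] in
/-- Shrinking the level: for non-zero `𝔪 ⊆ 𝔫` the thin coset `x₀ + (𝔪𝒪̂_K)^ι` lies in
`x₀ + (𝔫𝒪̂_K)^ι`. [folklore] -/
theorem thinCoset_mono (x₀ : ι → FiniteAdeleRing (𝓞 K) K) {𝔪 𝔫 : Ideal (𝓞 K)} (h𝔪 : 𝔪 ≠ 0)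
    (h : 𝔪 ≤ 𝔫) :
    x₀ +ᵥ (piLevelIdeal K ι 𝔪 : Set (ι → FiniteAdeleRing (𝓞 K) K)) ⊆
      x₀ +ᵥ (piLevelIdeal K ι 𝔫 : Set (ι → FiniteAdeleRing (𝓞 K) K)) :=
  Set.vadd_set_mono fun _ hl => piLevelIdeal_mono K h𝔪 h hl

/-! ### Linearity in the archimedean factor (families `e ↦ e ⊗ 1_{x₀ + 𝔫𝒪̂^ι}`) -/

/-- `thinCosetTestFun` is additive in the archimedean factor. [folklore] -/
theorem thinCosetTestFun_add (Φ Ψ : 𝓢((ι → mixedSpace K), ℂ)) (x₀ : ι → FiniteAdeleRing (𝓞 K) K)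
    (𝔫 : Ideal (𝓞 K)) :
    thinCosetTestFun K ι (Φ + Ψ) x₀ 𝔫 = thinCosetTestFun K ι Φ x₀ 𝔫 + thinCosetTestFun K ι Ψ x₀ 𝔫 := by
  funext v
  simp only [thinCosetTestFun, add_apply, Pi.add_apply, add_mul]

/-- `thinCosetTestFun` is homogeneous in the archimedean factor. [folklore] -/
theorem thinCosetTestFun_smul (c : ℂ) (Φ : 𝓢((ι → mixedSpace K), ℂ)) (x₀ : ι → FiniteAdeleRing (𝓞 K) K)
    (𝔫 : Ideal (𝓞 K)) :
    thinCosetTestFun K ι (c • Φ) x₀ 𝔫 = c • thinCosetTestFun K ι Φ x₀ 𝔫 := by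
  funext v
  simp only [thinCosetTestFun, _root_.smul_apply, Pi.smul_apply, smul_eq_mul, mul_assoc]

/-- **The thin-coset family as a linear map** `𝓢(X_∞) →ₗ[ℂ] piSchwartzBruhat`, `Φ_∞ ↦ Φ_∞ ⊗ 1_{x₀ + 𝔫𝒪̂^ι}` —
the shape in which theta FORMS are built from a `K_∞`-type of archimedean test vectors (a linear family of test
functions with a fixed finite part). [folklore] -/
def thinCosetTestFunₗ (x₀ : ι → FiniteAdeleRing (𝓞 K) K) (𝔫 : Ideal (𝓞 K)) :
    𝓢((ι → mixedSpace K), ℂ) →ₗ[ℂ] piSchwartzBruhat K ι where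
  toFun Φ := ⟨thinCosetTestFun K ι Φ x₀ 𝔫, thinCosetTestFun_mem_piSchwartzBruhat Φ x₀ 𝔫⟩
  map_add' Φ Ψ := Subtype.ext (thinCosetTestFun_add Φ Ψ x₀ 𝔫)
  map_smul' c Φ := Subtype.ext (thinCosetTestFun_smul c Φ x₀ 𝔫)

/-- `thinCosetTestFunₗ` on points. [folklore] -/
@[simp] theorem coe_thinCosetTestFunₗ (x₀ : ι → FiniteAdeleRing (𝓞 K) K) (𝔫 : Ideal (𝓞 K))
    (Φ : 𝓢((ι → mixedSpace K), ℂ)) :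
    ((thinCosetTestFunₗ (K := K) (ι := ι) x₀ 𝔫 Φ : piSchwartzBruhat K ι) : (ι → AdeleRing (𝓞 K) K) → ℂ) =
      thinCosetTestFun K ι Φ x₀ 𝔫 := rfl

end FiniteAdele

end Literature.NumberTheory.Automorphic
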